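import Mathlib
import Summits.NavierStokesRegularity.NavierStokesRegularity.Theorems.EulerZoomLiouvillePowerGaugeEulerLiouvilleTransportMoments
import Summits.NavierStokesRegularity.NavierStokesRegularity.Theorems.EulerZoomLiouvillePowerGaugeEulerLiouvilleBallMeanValueFormula
import Summits.NavierStokesRegularity.NavierStokesRegularity.Theorems.EulerZoomLiouvillePowerGaugeEulerLiouvilleBallFirstMoments
import HarnessLib

/-!
# R49 plate t52-TB, part 2: the TRANSPORT MEAN-VALUE FORMULA (`W`-form of Chae–Wolf (2.1)) about every centre
# (nsreg-p2 ROUND-49 «EVERY BALL BREATHES», `NsregP2.R49.TransportMeanValueFormula`, text `r49/Sketch49.lean` l.104–111 with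
# `transportW`/`modPressure` UNFOLDED; seat ns-sfl-p1 g8, `--supports stmt-NavierStokesRegularity-19832 --as helper`)

For a `γ`-profile `(V, P)` with similarity centre `c`, `W = γ(y − c) + V`, `Π = P − ½γ(1−γ)‖y − c‖²`, every centre `x₀` and
`δ > 0` (`z = y − x₀`):
`∫_{B_δ(x₀)} (⟪W,z⟫²/‖z‖ + ‖z‖Π) = ∫_{B_δ(x₀)} (δ − ‖z‖)(‖W‖² + 3Π) + (2π/15)γ(5γ−1)δ⁶`.

Proof: recentre the profile at `x₀` (`IsSelfSimilarEulerProfile.recenter`: `V′ = V + γ(x₀ − c)`, `P′ = P − (1−γ)γ⟪x₀ − c, ·⟫`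
is a `γ`-profile with centre `x₀`, same transport field `W = γz + V′`, and `Π = P′ − ½γ(1−γ)‖z‖² + K` with the constant
`K = γ(1−γ)(⟪x₀ − c, x₀⟫ − ½‖x₀ − c‖²)`); pointwise (`transportIntegrand_sub_eq`) the difference of the two integrands is the
`V′`-form difference of `MeanValueFormula` plus `2γ(2γ−1)‖z‖³ + ½γ(3−5γ)δ‖z‖² + 4K‖z‖ − 3Kδ + (4γ‖z‖ − 2γδ)⟪V′, z⟫`; integrate
with `meanValueFormula` (t52-MV), the first moments `∫⟪V′,z⟫ = ∫‖z‖⟪V′,z⟫ = 0` (ns-ezl-w2 g5's `integral_ball_inner_sub_eq_zero`,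
`integral_ball_norm_mul_inner_eq_zero`) and the radial moments `∫‖z‖ⁿ` (`…TransportMoments`):
`2γ(2γ−1)·2πδ⁶/3 + ½γ(3−5γ)δ·4πδ⁵/5 + 4Kπδ⁴ − 3Kδ·4πδ³/3 = (2π/15)γ(5γ−1)δ⁶`.

HONEST FRAMING: an instrument identity of ROUND-49 (class-free, about hypothetical profiles); nothing about the crux E (19832 OPEN)
or NS regularity is proved here. [cite: ChaeWolf2016, Lemma 2.1 (2.1)] [nsreg-p2 R49 §2.4; folklore]
-/

noncomputable section

set_option linter.dupNamespace false

open MeasureTheory Set Filter Topology Metric Function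
open scoped RealInnerProductSpace Topology

namespace Summit.NavierStokesRegularity.NavierStokesRegularity.Theorems.PowerGaugeEulerLiouville

open Literature.Analysis Literature.Analysis.FluidPDE

namespace ClassicalProfile

/-! ## The pointwise bookkeeping -/

/-- **Pointwise bookkeeping of the `W`-form.**  With `z = y − x₀`, `b = x₀ − c`, `V′ = V y + γb`, `P′ = P y − (1−γ)γ⟪b, y⟫`,
`K = γ(1−γ)(⟪b, x₀⟫ − ½‖b‖²)`: the difference «LHS integrand − RHS integrand» of the transport mean-value formula equals the
difference of the `V′`-integrands of `MeanValueFormula` plus `2γ(2γ−1)‖z‖³ + ½γ(3−5γ)δ‖z‖² + 4K‖z‖ − 3Kδ + (4γ‖z‖ − 2γδ)⟪V′, z⟫`.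
[folklore (algebra)] -/
theorem transportIntegrand_sub_eq (γ δ : ℝ) (c x₀ y : EuclideanSpace ℝ (Fin 3)) (V : EuclideanSpace ℝ (Fin 3) → EuclideanSpace ℝ (Fin 3))
    (P : EuclideanSpace ℝ (Fin 3) → ℝ) :
    (⟪γ • (y - c) + V y, y - x₀⟫ ^ 2 / ‖y - x₀‖ + ‖y - x₀‖ * (P y - γ * (1 - γ) / 2 * ‖y - c‖ ^ 2))
        - (δ - ‖y - x₀‖) * (‖γ • (y - c) + V y‖ ^ 2 + 3 * (P y - γ * (1 - γ) / 2 * ‖y - c‖ ^ 2))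
      = ((⟪V y + γ • (x₀ - c), y - x₀⟫ ^ 2 / ‖y - x₀‖ + ‖y - x₀‖ * (P y - (1 - γ) * γ * ⟪x₀ - c, y⟫))
          - (δ - ‖y - x₀‖) * (‖V y + γ • (x₀ - c)‖ ^ 2 + 3 * (P y - (1 - γ) * γ * ⟪x₀ - c, y⟫)))
        + (2 * γ * (2 * γ - 1) * ‖y - x₀‖ ^ 3 + γ * (3 - 5 * γ) / 2 * δ * ‖y - x₀‖ ^ 2
          + 4 * (γ * (1 - γ) * (⟪x₀ - c, x₀⟫ - ‖x₀ - c‖ ^ 2 / 2)) * ‖y - x₀‖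
          - 3 * (γ * (1 - γ) * (⟪x₀ - c, x₀⟫ - ‖x₀ - c‖ ^ 2 / 2)) * δ
          + (4 * γ * ‖y - x₀‖ - 2 * γ * δ) * ⟪V y + γ • (x₀ - c), y - x₀⟫) := by
  -- atoms
  have hW : γ • (y - c) + V y = γ • (y - x₀) + (V y + γ • (x₀ - c)) := by
    rw [show y - c = (y - x₀) + (x₀ - c) by abel, smul_add]; abel
  have hyc : ‖y - c‖ ^ 2 = ‖y - x₀‖ ^ 2 + 2 * ⟪y - x₀, x₀ - c⟫ + ‖x₀ - c‖ ^ 2 := by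
    rw [show y - c = (y - x₀) + (x₀ - c) by abel]
    exact norm_add_sq_real _ _
  have hy : ⟪x₀ - c, y⟫ = ⟪y - x₀, x₀ - c⟫ + ⟪x₀ - c, x₀⟫ := by
    rw [real_inner_comm (x₀ - c) (y - x₀), ← inner_add_right, sub_add_cancel]
  have hin : ⟪γ • (y - x₀) + (V y + γ • (x₀ - c)), y - x₀⟫ = γ * ‖y - x₀‖ ^ 2 + ⟪V y + γ • (x₀ - c), y - x₀⟫ := by
    rw [inner_add_left, real_inner_smul_left, real_inner_self_eq_norm_sq]
  have hnorm : ‖γ • (y - x₀) + (V y + γ • (x₀ - c))‖ ^ 2 =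
      γ ^ 2 * ‖y - x₀‖ ^ 2 + 2 * γ * ⟪V y + γ • (x₀ - c), y - x₀⟫ + ‖V y + γ • (x₀ - c)‖ ^ 2 := by
    rw [norm_add_sq_real, norm_smul, mul_pow, Real.norm_eq_abs, sq_abs, real_inner_smul_left, real_inner_comm]
    ring
  rw [hW, hin, hnorm, hyc, hy]
  -- scalar algebra; split at the centre
  by_cases hz : y - x₀ = 0
  · simp [hz]
    ring
  · have ht : ‖y - x₀‖ ≠ 0 := norm_ne_zero_iff.2 hz
    field_simp
    ring

/-! ## The transport mean-value formula -/

/-- **TRANSPORT MEAN-VALUE FORMULA** (`NsregP2.R49.TransportMeanValueFormula γ`, text VERBATIM with `transportW`/`modPressure`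
unfolded): for a `γ`-profile `(V, P)` with centre `c`, every `x₀` and `δ > 0`,
`∫_{B_δ(x₀)} (⟪W,z⟫²/‖z‖ + ‖z‖Π) = ∫_{B_δ(x₀)} (δ − ‖z‖)(‖W‖² + 3Π) + (2π/15)γ(5γ−1)δ⁶`,
`W = γ(y−c) + V`, `Π = P − ½γ(1−γ)‖y−c‖²`. [cite: ChaeWolf2016, Lemma 2.1 (2.1)] [nsreg-p2 R49 §2.4] -/
theorem transportMeanValueFormula (γ : ℝ) :
    ∀ (c : EuclideanSpace ℝ (Fin 3)) (V : EuclideanSpace ℝ (Fin 3) → EuclideanSpace ℝ (Fin 3)) (P : EuclideanSpace ℝ (Fin 3) → ℝ),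
      IsSelfSimilarEulerProfile γ c V P →
      ∀ (x₀ : EuclideanSpace ℝ (Fin 3)) (δ : ℝ), 0 < δ →
        ∫ y in ball x₀ δ, (⟪γ • (y - c) + V y, y - x₀⟫ ^ 2 / ‖y - x₀‖
            + ‖y - x₀‖ * (P y - γ * (1 - γ) / 2 * ‖y - c‖ ^ 2))
          = (∫ y in ball x₀ δ, (δ - ‖y - x₀‖) * (‖γ • (y - c) + V y‖ ^ 2
              + 3 * (P y - γ * (1 - γ) / 2 * ‖y - c‖ ^ 2)))
            + 2 * Real.pi / 15 * γ * (5 * γ - 1) * δ ^ 6 := by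
  intro c V P hprof x₀ δ hδ
  -- the recentred profile `(V′, P′)` with centre `x₀`
  have hprof' := hprof.recenter (x₀ - c)
  have hV1' : ContDiff ℝ 1 (fun y => V y + γ • (x₀ - c)) := hprof'.contDiff_velocity.of_le (by norm_cast)
  have hVc' : Continuous (fun y => V y + γ • (x₀ - c)) := hV1'.continuous
  have hPc' : Continuous (fun y => P y - (1 - γ) * γ * ⟪x₀ - c, y⟫) := hprof'.contDiff_pressure.continuous
  have hVc : Continuous V := hprof.contDiff_velocity.continuous
  have hPc : Continuous P := hprof.contDiff_pressure.continuous
  -- inputs: MV for `(V′, P′)`, the two first moments, the radial moments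
  have hMV := meanValueFormula γ (c + (x₀ - c)) _ _ hprof' x₀ δ hδ
  have hm0 := integral_ball_inner_sub_eq_zero hV1' hprof'.divFree x₀ hδ
  have hm1 := integral_ball_norm_mul_inner_eq_zero hV1' hprof'.divFree x₀ δ
  have hM0 := integral_ball_one_eq x₀ hδ.le
  have hM1 := integral_ball_norm_sub_eq x₀ hδ.le
  have hM2 := integral_ball_norm_sub_sq x₀ hδ
  have hM3 := integral_ball_norm_sub_pow_three x₀ hδ.le
  -- abbreviations
  set K : ℝ := γ * (1 - γ) * (⟪x₀ - c, x₀⟫ - ‖x₀ - c‖ ^ 2 / 2) with hK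
  have hcn : Continuous fun y : EuclideanSpace ℝ (Fin 3) => ‖y - x₀‖ := continuous_norm.comp (continuous_sub_right x₀)
  have hci : Continuous fun y : EuclideanSpace ℝ (Fin 3) => ⟪V y + γ • (x₀ - c), y - x₀⟫ :=
    hVc'.inner (continuous_id.sub continuous_const)
  have hKc : IsCompact (closedBall x₀ δ) := isCompact_closedBall x₀ δ
  have intC : ∀ {f : EuclideanSpace ℝ (Fin 3) → ℝ}, Continuous f → IntegrableOn f (ball x₀ δ) volume := fun hf =>
    (hf.continuousOn.integrableOn_compact hKc).mono_set ball_subset_closedBall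
  -- integrability of the singular integrands `⟪U, z⟫²/‖z‖ + ‖z‖·p`
  have intL : ∀ {U : EuclideanSpace ℝ (Fin 3) → EuclideanSpace ℝ (Fin 3)} {p : EuclideanSpace ℝ (Fin 3) → ℝ},
      Continuous U → Continuous p →
      IntegrableOn (fun y => ⟪U y, y - x₀⟫ ^ 2 / ‖y - x₀‖ + ‖y - x₀‖ * p y) (ball x₀ δ) volume := by
    intro U p hU hp
    have hc : Continuous fun y => ‖U y‖ ^ 2 * ‖y - x₀‖ + ‖y - x₀‖ * |p y| := by fun_prop
    have hUi : Continuous fun y : EuclideanSpace ℝ (Fin 3) => ⟪U y, y - x₀⟫ := hU.inner (continuous_id.sub continuous_const)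
    refine Integrable.mono' (intC hc) ((((hUi.measurable.pow_const 2).div hcn.measurable).add
      (hcn.measurable.mul hp.measurable)).aestronglyMeasurable) (ae_of_all _ fun y => ?_)
    rw [Real.norm_eq_abs]
    calc |⟪U y, y - x₀⟫ ^ 2 / ‖y - x₀‖ + ‖y - x₀‖ * p y|
        ≤ |⟪U y, y - x₀⟫ ^ 2 / ‖y - x₀‖| + |‖y - x₀‖ * p y| := abs_add_le _ _
      _ ≤ ‖U y‖ ^ 2 * ‖y - x₀‖ + ‖y - x₀‖ * |p y| := by
          rw [abs_of_nonneg (div_nonneg (sq_nonneg _) (norm_nonneg _)), abs_mul, abs_of_nonneg (norm_nonneg _)]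
          gcongr
          exact inner_sq_div_norm_le (U y) (y - x₀)
  -- the text integrands and their integrability
  have hWc : Continuous fun y => γ • (y - c) + V y := by fun_prop
  have hPic : Continuous fun y => P y - γ * (1 - γ) / 2 * ‖y - c‖ ^ 2 := by fun_prop
  have iL := intL hWc hPic
  have iR : IntegrableOn (fun y => (δ - ‖y - x₀‖) * (‖γ • (y - c) + V y‖ ^ 2
      + 3 * (P y - γ * (1 - γ) / 2 * ‖y - c‖ ^ 2))) (ball x₀ δ) volume := intC (by fun_prop)
  have iL' := intL hVc' hPc'
  have iR' : IntegrableOn (fun y => (δ - ‖y - x₀‖) * (‖V y + γ • (x₀ - c)‖ ^ 2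
      + 3 * (P y - (1 - γ) * γ * ⟪x₀ - c, y⟫))) (ball x₀ δ) volume := intC (by fun_prop)
  -- the remainder terms
  have i3 : IntegrableOn (fun y => 2 * γ * (2 * γ - 1) * ‖y - x₀‖ ^ 3) (ball x₀ δ) volume := intC (by fun_prop)
  have i2 : IntegrableOn (fun y => γ * (3 - 5 * γ) / 2 * δ * ‖y - x₀‖ ^ 2) (ball x₀ δ) volume := intC (by fun_prop)
  have i1 : IntegrableOn (fun y => 4 * K * ‖y - x₀‖) (ball x₀ δ) volume := intC (by fun_prop)
  have i0 : IntegrableOn (fun _ => 3 * K * δ) (ball x₀ δ) volume := intC (by fun_prop)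
  have iS : IntegrableOn (fun y => (4 * γ * ‖y - x₀‖ - 2 * γ * δ) * ⟪V y + γ • (x₀ - c), y - x₀⟫) (ball x₀ δ) volume :=
    intC (((continuous_const.mul hcn).sub continuous_const).mul hci)
  -- integrate the pointwise bookkeeping
  have hpt : ∀ y : EuclideanSpace ℝ (Fin 3),
      (⟪γ • (y - c) + V y, y - x₀⟫ ^ 2 / ‖y - x₀‖ + ‖y - x₀‖ * (P y - γ * (1 - γ) / 2 * ‖y - c‖ ^ 2))
        - (δ - ‖y - x₀‖) * (‖γ • (y - c) + V y‖ ^ 2 + 3 * (P y - γ * (1 - γ) / 2 * ‖y - c‖ ^ 2))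
      = ((⟪V y + γ • (x₀ - c), y - x₀⟫ ^ 2 / ‖y - x₀‖ + ‖y - x₀‖ * (P y - (1 - γ) * γ * ⟪x₀ - c, y⟫))
          - (δ - ‖y - x₀‖) * (‖V y + γ • (x₀ - c)‖ ^ 2 + 3 * (P y - (1 - γ) * γ * ⟪x₀ - c, y⟫)))
        + (2 * γ * (2 * γ - 1) * ‖y - x₀‖ ^ 3 + γ * (3 - 5 * γ) / 2 * δ * ‖y - x₀‖ ^ 2
          + 4 * K * ‖y - x₀‖ - 3 * K * δ
          + (4 * γ * ‖y - x₀‖ - 2 * γ * δ) * ⟪V y + γ • (x₀ - c), y - x₀⟫) := by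
    intro y
    have h := transportIntegrand_sub_eq γ δ c x₀ y V P
    rw [hK]
    exact h
  have hsum := integral_congr_ae (μ := volume.restrict (ball x₀ δ)) (ae_of_all _ hpt)
  have h2 : IntegrableOn (fun y => 2 * γ * (2 * γ - 1) * ‖y - x₀‖ ^ 3 + γ * (3 - 5 * γ) / 2 * δ * ‖y - x₀‖ ^ 2)
      (ball x₀ δ) volume := i3.add i2
  have h3 : IntegrableOn (fun y => 2 * γ * (2 * γ - 1) * ‖y - x₀‖ ^ 3 + γ * (3 - 5 * γ) / 2 * δ * ‖y - x₀‖ ^ 2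
      + 4 * K * ‖y - x₀‖) (ball x₀ δ) volume := h2.add i1
  have h4 : IntegrableOn (fun y => 2 * γ * (2 * γ - 1) * ‖y - x₀‖ ^ 3 + γ * (3 - 5 * γ) / 2 * δ * ‖y - x₀‖ ^ 2
      + 4 * K * ‖y - x₀‖ - 3 * K * δ) (ball x₀ δ) volume := h3.sub i0
  have h5 : IntegrableOn (fun y => 2 * γ * (2 * γ - 1) * ‖y - x₀‖ ^ 3 + γ * (3 - 5 * γ) / 2 * δ * ‖y - x₀‖ ^ 2
      + 4 * K * ‖y - x₀‖ - 3 * K * δ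
      + (4 * γ * ‖y - x₀‖ - 2 * γ * δ) * ⟪V y + γ • (x₀ - c), y - x₀⟫) (ball x₀ δ) volume := h4.add iS
  have hMVint : IntegrableOn (fun y =>
      (⟪V y + γ • (x₀ - c), y - x₀⟫ ^ 2 / ‖y - x₀‖ + ‖y - x₀‖ * (P y - (1 - γ) * γ * ⟪x₀ - c, y⟫))
        - (δ - ‖y - x₀‖) * (‖V y + γ • (x₀ - c)‖ ^ 2 + 3 * (P y - (1 - γ) * γ * ⟪x₀ - c, y⟫)))
      (ball x₀ δ) volume := iL'.sub iR'
  rw [integral_sub iL iR, integral_add hMVint h5, integral_sub iL' iR', integral_add h4 iS,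
    integral_sub h3 i0, integral_add h2 i1, integral_add i3 i2] at hsum
  -- evaluate the remainder
  have e3 : ∫ y in ball x₀ δ, 2 * γ * (2 * γ - 1) * ‖y - x₀‖ ^ 3 = 2 * γ * (2 * γ - 1) * (2 * Real.pi * δ ^ 6 / 3) := by
    rw [integral_const_mul, hM3]
  have e2 : ∫ y in ball x₀ δ, γ * (3 - 5 * γ) / 2 * δ * ‖y - x₀‖ ^ 2 =
      γ * (3 - 5 * γ) / 2 * δ * (4 * Real.pi / 5 * δ ^ 5) := by
    rw [integral_const_mul, hM2]
  have e1 : ∫ y in ball x₀ δ, 4 * K * ‖y - x₀‖ = 4 * K * (Real.pi * δ ^ 4) := by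
    rw [integral_const_mul, hM1]
  have e0 : ∫ _y in ball x₀ δ, 3 * K * δ = 3 * K * δ * (4 * Real.pi * δ ^ 3 / 3) := by
    rw [← hM0, ← integral_const_mul]; simp
  have eS : ∫ y in ball x₀ δ, (4 * γ * ‖y - x₀‖ - 2 * γ * δ) * ⟪V y + γ • (x₀ - c), y - x₀⟫ = 0 := by
    have ia : IntegrableOn (fun y => 4 * γ * (‖y - x₀‖ * ⟪V y + γ • (x₀ - c), y - x₀⟫)) (ball x₀ δ) volume :=
      intC ((hcn.mul hci).const_mul _)
    have ib : IntegrableOn (fun y => 2 * γ * δ * ⟪V y + γ • (x₀ - c), y - x₀⟫) (ball x₀ δ) volume :=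
      intC (hci.const_mul _)
    have e : (fun y => (4 * γ * ‖y - x₀‖ - 2 * γ * δ) * ⟪V y + γ • (x₀ - c), y - x₀⟫) =
        fun y => 4 * γ * (‖y - x₀‖ * ⟪V y + γ • (x₀ - c), y - x₀⟫) - 2 * γ * δ * ⟪V y + γ • (x₀ - c), y - x₀⟫ := by
      funext y; ring
    rw [e, integral_sub ia ib, integral_const_mul, integral_const_mul, hm1, hm0]
    ring
  -- MV for the recentred profile kills the first bracket
  have hMV0 : (∫ y in ball x₀ δ, (⟪V y + γ • (x₀ - c), y - x₀⟫ ^ 2 / ‖y - x₀‖ + ‖y - x₀‖ * (P y - (1 - γ) * γ * ⟪x₀ - c, y⟫)))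
      - ∫ y in ball x₀ δ, (δ - ‖y - x₀‖) * (‖V y + γ • (x₀ - c)‖ ^ 2 + 3 * (P y - (1 - γ) * γ * ⟪x₀ - c, y⟫)) = 0 := by
    rw [hMV]; ring
  rw [hMV0, e3, e2, e1, e0, eS] at hsum
  have hfinal : (∫ y in ball x₀ δ, (⟪γ • (y - c) + V y, y - x₀⟫ ^ 2 / ‖y - x₀‖
        + ‖y - x₀‖ * (P y - γ * (1 - γ) / 2 * ‖y - c‖ ^ 2)))
      - (∫ y in ball x₀ δ, (δ - ‖y - x₀‖) * (‖γ • (y - c) + V y‖ ^ 2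
        + 3 * (P y - γ * (1 - γ) / 2 * ‖y - c‖ ^ 2)))
      = 2 * Real.pi / 15 * γ * (5 * γ - 1) * δ ^ 6 := by
    rw [hsum]; ring
  linarith

end ClassicalProfile

end Summit.NavierStokesRegularity.NavierStokesRegularity.Theorems.PowerGaugeEulerLiouville

end
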